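import Summits.Ventures.HodgeRepro2.T5SU11JacobiWeightRecursion
import Summits.Ventures.HodgeRepro2.T5SU11JacobiRatioLimit
import Summits.Ventures.HodgeRepro2.T5SU11JacobiCompleteMonotonePhase

/-!
# The moment generating function of the phase is the decay ratio; the orbit radius in closed form

Under the probability measure `m_k φ_λ dν/m̂_k(λ)` the Laplace transform (moment generating function) of
the phase `s(g) = log|a(g)|` is the decay ratio of the Jacobi transform in the weight:

  **`E_{k,λ}[e^{−h s}] = E_{k,λ}[|a|^{−h}] = m̂_{k+h}(λ)/m̂_k(λ)`**,  `h ≥ 0`   (`mgf_phase_eq_ratio`)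

(`e^{−hs} m_k = m_{k+h}`, `T5SU11JacobiCompleteMonotone.orbit_rpow_add`) — so the monotonicity of the decay
ratio in `k` (`T5SU11JacobiCompleteMonotonePhase.jacobi_ratio_le`) says the phase is stochastically
decreasing in the weight in the Laplace order, and its limit `1` (`T5SU11JacobiRatioLimit`) that the
phase tends to `0` in law. At `h = 2`, `|a|^{−2} = 1 − |g·0|²`, and the recursion
`m̂_{k+2} = r_k(λ) m̂_k` (`T5SU11JacobiWeightRecursion`) gives **the mean squared orbit radius in closed
form for every `λ`**:

  **`E_{k,λ}[|g·0|²] = 1 − r_k(λ) = (2k − λ(2 − λ))/k²`**   (`mean_orbit_sq_eq`)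

(at `λ = 0`: `2/k`, the mean of the Beta law `T5SU11OrbitRadiusLaw`), with the variance
`Var_{k,λ}(|g·0|²) = r_k(λ) (r_{k+2}(λ) − r_k(λ)) > 0` (`variance_orbit_sq_eq`, `variance_orbit_sq_pos` —
positive exactly because the ratio is strictly increasing in the weight), and `k · E_{k,λ}[|g·0|²] → 2`
(`tendsto_mul_mean_orbit_sq`). Nothing is claimed about (N).

Blind lane: Mathlib + the HodgeRepro2 prefix only; no sorry; axioms ⊆ {propext, Classical.choice,
Quot.sound}.
-/

namespace Summit.Ventures.HodgeRepro2.T5SU11JacobiPhaseMGF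

open MeasureTheory MeasureTheory.Measure Metric Set Filter Topology
open T5SU11Unimodular T5SU11Fibration T5SU11Cartan T5HaarCircle T5BergmanCoefficient
  T5SU11FibrationHaar T5SU11SphericalFunction T5SU11SphericalSymmetry T5SU11SphericalBounds
  T5SU11SphericalContinuous T5SU11JacobiIwasawa T5SU11JacobiTransform T5SU11JacobiWeight
  T5SU11KFiniteMajorantPow T5SU11JacobiDuplication T5SU11JacobiWeightRecursion
  T5SU11JacobiWeightAsymptotic T5SU11JacobiRatioLimit T5SU11JacobiCompleteMonotone
  T5SU11JacobiCompleteMonotonePhase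
open scoped Real

/-- `|a(g)|^{−h} = m_h(g)` for every real `h`: `e^{−h log|a(g)|} = (1 − |g·0|²)^{h/2}`. -/
theorem exp_neg_mul_log_eq_orbit_rpow (h : ℝ) (g : SU11) :
    Real.exp (-(h * Real.log ‖mat g 0 0‖)) = (1 - ‖orbit g‖ ^ 2) ^ (h / 2) :=
  (orbit_rpow_eq_exp h g).symm

/-- `1 − |g·0|² = m_2(g)`. -/
theorem one_sub_norm_orbit_sq_eq_rpow_two (g : SU11) :
    1 - ‖orbit g‖ ^ 2 = (1 - ‖orbit g‖ ^ 2) ^ ((2 : ℝ) / 2) := by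
  rw [show (2 : ℝ) / 2 = 1 by norm_num, Real.rpow_one]

section measure

variable [MeasurableSpace Circle] [BorelSpace Circle]

omit [BorelSpace Circle] in
/-- **The moment generating function of the phase is the decay ratio**: for `k` on the ray and `h ≥ 0`,
`∫_G e^{−h log|a|} m_k φ_λ dν = m̂_{k+h}(λ)`, i.e. `E_{k,λ}[|a|^{−h}] = m̂_{k+h}(λ)/m̂_k(λ)`. -/
theorem integral_exp_neg_mul_log_mul_eq (lam k h : ℝ) :
    ∫ g, Real.exp (-(h * Real.log ‖mat g 0 0‖)) * ((1 - ‖orbit g‖ ^ 2) ^ (k / 2) * sph lam g)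
        ∂(nu haarCircle)
      = ∫ g, (1 - ‖orbit g‖ ^ 2) ^ ((k + h) / 2) * sph lam g ∂(nu haarCircle) := by
  refine integral_congr_ae (Filter.Eventually.of_forall fun g => ?_)
  simp only
  rw [exp_neg_mul_log_eq_orbit_rpow, orbit_rpow_add]
  ring

omit [BorelSpace Circle] in
/-- `E_{k,λ}[e^{−h s}] = m̂_{k+h}(λ)/m̂_k(λ)`. -/
theorem mgf_phase_eq_ratio (lam k h : ℝ) :
    (∫ g, Real.exp (-(h * Real.log ‖mat g 0 0‖)) * ((1 - ‖orbit g‖ ^ 2) ^ (k / 2) * sph lam g)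
        ∂(nu haarCircle)) / ∫ g, (1 - ‖orbit g‖ ^ 2) ^ (k / 2) * sph lam g ∂(nu haarCircle)
      = (∫ g, (1 - ‖orbit g‖ ^ 2) ^ ((k + h) / 2) * sph lam g ∂(nu haarCircle))
        / ∫ g, (1 - ‖orbit g‖ ^ 2) ^ (k / 2) * sph lam g ∂(nu haarCircle) := by
  rw [integral_exp_neg_mul_log_mul_eq]

/-! ### The orbit radius -/

/-- `∫_G |g·0|² m_k φ_λ dν = m̂_k(λ) − m̂_{k+2}(λ)` on the ray. -/
theorem integral_norm_orbit_sq_mul_eq {k lam : ℝ} (hk : 1 < k) (h1 : lam < k) (h2 : 2 < k + lam) :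
    ∫ g, ‖orbit g‖ ^ 2 * ((1 - ‖orbit g‖ ^ 2) ^ (k / 2) * sph lam g) ∂(nu haarCircle)
      = (∫ g, (1 - ‖orbit g‖ ^ 2) ^ (k / 2) * sph lam g ∂(nu haarCircle))
        - ∫ g, (1 - ‖orbit g‖ ^ 2) ^ ((k + 2) / 2) * sph lam g ∂(nu haarCircle) := by
  rw [← integral_sub (integrable_orbit_rpow_mul_sph hk h1 h2)
    (integrable_orbit_rpow_mul_sph (by linarith) (by linarith) (by linarith))]
  refine integral_congr_ae (Filter.Eventually.of_forall fun g => ?_)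
  simp only
  rw [orbit_rpow_add, show (2 : ℝ) / 2 = 1 by norm_num, Real.rpow_one]
  ring

/-- **THE MEAN SQUARED ORBIT RADIUS IN CLOSED FORM**: on the ray,
`E_{k,λ}[|g·0|²] = 1 − r_k(λ) = (2k − λ(2 − λ))/k²`. -/
theorem mean_orbit_sq_eq {k lam : ℝ} (hk : 1 < k) (h1 : lam < k) (h2 : 2 < k + lam) :
    (∫ g, ‖orbit g‖ ^ 2 * ((1 - ‖orbit g‖ ^ 2) ^ (k / 2) * sph lam g) ∂(nu haarCircle))
        / ∫ g, (1 - ‖orbit g‖ ^ 2) ^ (k / 2) * sph lam g ∂(nu haarCircle)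
      = 1 - weightRatio k lam := by
  rw [integral_norm_orbit_sq_mul_eq hk h1 h2, jacobi_weight_add_two hk h1 h2, sub_div,
    div_self (jacobi_pos hk h1 h2).ne', mul_div_assoc, div_self (jacobi_pos hk h1 h2).ne', mul_one]

/-- The same, spelled out: `E_{k,λ}[|g·0|²] = (2k − λ(2 − λ))/k²`. -/
theorem mean_orbit_sq_eq' {k lam : ℝ} (hk : 1 < k) (h1 : lam < k) (h2 : 2 < k + lam) :
    (∫ g, ‖orbit g‖ ^ 2 * ((1 - ‖orbit g‖ ^ 2) ^ (k / 2) * sph lam g) ∂(nu haarCircle))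
        / ∫ g, (1 - ‖orbit g‖ ^ 2) ^ (k / 2) * sph lam g ∂(nu haarCircle)
      = (2 * k - lam * (2 - lam)) / k ^ 2 := by
  rw [mean_orbit_sq_eq hk h1 h2, weightRatio_eq (by linarith)]
  have hk0 : k ≠ 0 := by linarith
  field_simp
  ring

/-- `∫_G |g·0|⁴ m_k φ_λ dν = m̂_k − 2 m̂_{k+2} + m̂_{k+4}` on the ray. -/
theorem integral_norm_orbit_pow_four_mul_eq {k lam : ℝ} (hk : 1 < k) (h1 : lam < k)
    (h2 : 2 < k + lam) :
    ∫ g, (‖orbit g‖ ^ 2) ^ 2 * ((1 - ‖orbit g‖ ^ 2) ^ (k / 2) * sph lam g) ∂(nu haarCircle)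
      = (∫ g, (1 - ‖orbit g‖ ^ 2) ^ (k / 2) * sph lam g ∂(nu haarCircle))
        - 2 * ∫ g, (1 - ‖orbit g‖ ^ 2) ^ ((k + 2) / 2) * sph lam g ∂(nu haarCircle)
        + ∫ g, (1 - ‖orbit g‖ ^ 2) ^ ((k + 4) / 2) * sph lam g ∂(nu haarCircle) := by
  have i0 := integrable_orbit_rpow_mul_sph hk h1 h2
  have i2 : Integrable (fun g => (1 - ‖orbit g‖ ^ 2) ^ ((k + 2) / 2) * sph lam g) (nu haarCircle) :=
    integrable_orbit_rpow_mul_sph (by linarith) (by linarith) (by linarith)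
  have i4 : Integrable (fun g => (1 - ‖orbit g‖ ^ 2) ^ ((k + 4) / 2) * sph lam g) (nu haarCircle) :=
    integrable_orbit_rpow_mul_sph (by linarith) (by linarith) (by linarith)
  have i02 : Integrable (fun g => (1 - ‖orbit g‖ ^ 2) ^ (k / 2) * sph lam g
      - 2 * ((1 - ‖orbit g‖ ^ 2) ^ ((k + 2) / 2) * sph lam g)) (nu haarCircle) :=
    i0.sub (i2.const_mul 2)
  have key : ∀ g : SU11, (‖orbit g‖ ^ 2) ^ 2 * ((1 - ‖orbit g‖ ^ 2) ^ (k / 2) * sph lam g)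
      = ((1 - ‖orbit g‖ ^ 2) ^ (k / 2) * sph lam g - 2 * ((1 - ‖orbit g‖ ^ 2) ^ ((k + 2) / 2) * sph lam g))
        + (1 - ‖orbit g‖ ^ 2) ^ ((k + 4) / 2) * sph lam g := fun g => by
    rw [show (k + 4) / 2 = (k + 2 + 2) / 2 by ring, orbit_rpow_add (k + 2), orbit_rpow_add k,
      show (2 : ℝ) / 2 = 1 by norm_num, Real.rpow_one]
    ring
  calc ∫ g, (‖orbit g‖ ^ 2) ^ 2 * ((1 - ‖orbit g‖ ^ 2) ^ (k / 2) * sph lam g) ∂(nu haarCircle)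
      = ∫ g, (((1 - ‖orbit g‖ ^ 2) ^ (k / 2) * sph lam g
          - 2 * ((1 - ‖orbit g‖ ^ 2) ^ ((k + 2) / 2) * sph lam g))
          + (1 - ‖orbit g‖ ^ 2) ^ ((k + 4) / 2) * sph lam g) ∂(nu haarCircle) :=
        integral_congr_ae (Filter.Eventually.of_forall key)
    _ = (∫ g, ((1 - ‖orbit g‖ ^ 2) ^ (k / 2) * sph lam g
          - 2 * ((1 - ‖orbit g‖ ^ 2) ^ ((k + 2) / 2) * sph lam g)) ∂(nu haarCircle))
          + ∫ g, (1 - ‖orbit g‖ ^ 2) ^ ((k + 4) / 2) * sph lam g ∂(nu haarCircle) :=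
        integral_add i02 i4
    _ = ((∫ g, (1 - ‖orbit g‖ ^ 2) ^ (k / 2) * sph lam g ∂(nu haarCircle))
          - ∫ g, 2 * ((1 - ‖orbit g‖ ^ 2) ^ ((k + 2) / 2) * sph lam g) ∂(nu haarCircle))
          + ∫ g, (1 - ‖orbit g‖ ^ 2) ^ ((k + 4) / 2) * sph lam g ∂(nu haarCircle) := by
        rw [integral_sub i0 (i2.const_mul 2)]
    _ = _ := by rw [integral_const_mul]

/-- **The variance of the squared orbit radius**: on the ray,
`Var_{k,λ}(|g·0|²) = r_k(λ) (r_{k+2}(λ) − r_k(λ))`. -/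
theorem variance_orbit_sq_eq {k lam : ℝ} (hk : 1 < k) (h1 : lam < k) (h2 : 2 < k + lam) :
    (∫ g, (‖orbit g‖ ^ 2) ^ 2 * ((1 - ‖orbit g‖ ^ 2) ^ (k / 2) * sph lam g) ∂(nu haarCircle))
          / (∫ g, (1 - ‖orbit g‖ ^ 2) ^ (k / 2) * sph lam g ∂(nu haarCircle))
        - ((∫ g, ‖orbit g‖ ^ 2 * ((1 - ‖orbit g‖ ^ 2) ^ (k / 2) * sph lam g) ∂(nu haarCircle))
          / (∫ g, (1 - ‖orbit g‖ ^ 2) ^ (k / 2) * sph lam g ∂(nu haarCircle))) ^ 2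
      = weightRatio k lam * (weightRatio (k + 2) lam - weightRatio k lam) := by
  rw [mean_orbit_sq_eq hk h1 h2, integral_norm_orbit_pow_four_mul_eq hk h1 h2,
    show (k + 4) / 2 = (k + 2 + 2) / 2 by ring,
    jacobi_weight_add_two (k := k + 2) (lam := lam) (by linarith) (by linarith) (by linarith),
    jacobi_weight_add_two hk h1 h2]
  have hm : ∫ g, (1 - ‖orbit g‖ ^ 2) ^ (k / 2) * sph lam g ∂(nu haarCircle) ≠ 0 :=
    (jacobi_pos hk h1 h2).ne'
  field_simp
  ring

/-- `Var_{k,λ}(|g·0|²) > 0` on the ray (the ratio is strictly increasing in the weight). -/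
theorem variance_orbit_sq_pos {k lam : ℝ} (hk : 1 < k) (h1 : lam < k) (h2 : 2 < k + lam) :
    0 < (∫ g, (‖orbit g‖ ^ 2) ^ 2 * ((1 - ‖orbit g‖ ^ 2) ^ (k / 2) * sph lam g) ∂(nu haarCircle))
          / (∫ g, (1 - ‖orbit g‖ ^ 2) ^ (k / 2) * sph lam g ∂(nu haarCircle))
        - ((∫ g, ‖orbit g‖ ^ 2 * ((1 - ‖orbit g‖ ^ 2) ^ (k / 2) * sph lam g) ∂(nu haarCircle))
          / (∫ g, (1 - ‖orbit g‖ ^ 2) ^ (k / 2) * sph lam g ∂(nu haarCircle))) ^ 2 := by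
  rw [variance_orbit_sq_eq hk h1 h2]
  exact mul_pos (weightRatio_pos h1 h2)
    (sub_pos.mpr (weightRatio_lt_weightRatio hk (by linarith)))

/-- **`k · E_{k,λ}[|g·0|²] → 2`** as `k → ∞`, for every `λ`. -/
theorem tendsto_mul_mean_orbit_sq (lam : ℝ) :
    Tendsto (fun k : ℝ => k
        * ((∫ g, ‖orbit g‖ ^ 2 * ((1 - ‖orbit g‖ ^ 2) ^ (k / 2) * sph lam g) ∂(nu haarCircle))
          / ∫ g, (1 - ‖orbit g‖ ^ 2) ^ (k / 2) * sph lam g ∂(nu haarCircle)))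
      atTop (𝓝 2) := by
  have h0 : Tendsto (fun k : ℝ => lam * (2 - lam) / k) atTop (𝓝 0) :=
    tendsto_id.const_div_atTop (lam * (2 - lam))
  have h : Tendsto (fun k : ℝ => 2 - lam * (2 - lam) / k) atTop (𝓝 (2 - 0)) := tendsto_const_nhds.sub h0
  rw [sub_zero] at h
  refine h.congr' ?_
  filter_upwards [eventually_gt_atTop (max 1 (max lam (2 - lam)))] with k hk
  rw [max_lt_iff, max_lt_iff] at hk
  rw [mean_orbit_sq_eq' hk.1 hk.2.1 (by linarith [hk.2.2])]
  have hk0 : k ≠ 0 := by linarith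
  field_simp

end measure

end Summit.Ventures.HodgeRepro2.T5SU11JacobiPhaseMGF
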